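import Mathlib
import HarnessLib
import Literature.Probability.LatticeModels.LatticeGraph
import Summits.HubbardSuperconductivity.HubbardSuperconductivity.Theorems.BalabanIRBirComplexStableXYFixedVolumeLaplace
import Summits.HubbardSuperconductivity.HubbardSuperconductivity.Theorems.BalabanIRBirComplexStableXYFixedVolumeLaplaceRate
import Summits.HubbardSuperconductivity.HubbardSuperconductivity.Theorems.BalabanIRBirComplexStableXYFixedVolumeGaussCompact
import Summits.HubbardSuperconductivity.HubbardSuperconductivity.Theorems.BalabanIRBirComplexStableXYFixedVolumeTorus
import Summits.HubbardSuperconductivity.HubbardSuperconductivity.Theorems.BalabanIRBirComplexStableXYFixedVolumeExpansion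
import Summits.HubbardSuperconductivity.HubbardSuperconductivity.Theorems.BalabanIRBirComplexStableXYFixedVolumeAction
import Summits.HubbardSuperconductivity.HubbardSuperconductivity.Theorems.BalabanIRBirComplexStableXYFixedVolumeLattice
import Summits.HubbardSuperconductivity.HubbardSuperconductivity.Theorems.BalabanIRBirComplexStableXYFixedVolumeCoercive
import Summits.HubbardSuperconductivity.HubbardSuperconductivity.Theorems.BalabanIRBirComplexStableXYFixedVolumeUniformBounds

/-!
# BalabanIR engine `BirComplexStableXY` (stmt-HubbardSuperconductivity-2080): fixed-volume
stability UNIFORM over the admissible class — the core estimate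

Support lemmas for crux 2 of route BalabanIR (`--supports stmt-HubbardSuperconductivity-2080`),
core of the sharp form of the fixed-volume analysis (assembled in `…FixedVolumeUniform.lean`): the threshold `K₁` can be chosen depending only on
`(r, B, c₀, L, M)`, i.e. UNIFORMLY over all Fourier tables `c` satisfying (U1), (N), (A), (C):

  `birFixedVolume_uniform_stable`:
  `∀ r ≥ 2, ∀ B, ∀ c₀ > 0, ∀ L M ≥ 1, ∃ K₁, ∀ K ≥ K₁, ∀ c admissible, Z ≠ 0 ∧ 1/2 ≤ Re (∫ O e^{-A}/Z)`

for the objects exactly as typed in `Theses.BalabanIR.BirComplexStableXY`.  Compared with the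
crux, ONLY the order of `∃ K₀` and `∀ L M` is exchanged (and `L₀` dropped): the typed engine claim
is precisely the assertion that this `K₁(r, B, c₀, L, M)` can be taken independent of `(L, M)` —
which is where the Beraha–Kahane–Weiss zeros of the refuter record (`M ~ K² L⁴`) say it fails.

Proof: the `O(1/√K)` Laplace rate (`birLaplace_rate`) with constants uniform in `c`
(`birUnif_coercive`, `birUnif_remainder_const_le`, `birUnif_entry_le`, `birUnif_O_lipschitz`)
and the uniform lower bound for the limiting Gaussian integral (`birGauss_uniform_lower_bound`).
No definitions.
-/

namespace Summit.HubbardSuperconductivity.HubbardSuperconductivity.Theorems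

open scoped BigOperators
open MeasureTheory Set Complex Filter Topology Literature.Probability.LatticeModels

section Uniform

/-- Ratio control: if `a` and `b` are both within `g₀/8` of some `G` with `‖G‖ ≥ g₀ > 0`, then
`b ≠ 0` and `Re (a / b) ≥ 1/2`. -/
theorem birUnif_ratio {a b G : ℂ} {g₀ ε₁ ε₂ : ℝ} (hg₀ : 0 < g₀) (hG : g₀ ≤ ‖G‖)
    (ha : ‖a - G‖ ≤ ε₁) (hb : ‖b - G‖ ≤ ε₂) (h1 : ε₁ ≤ g₀ / 8) (h2 : ε₂ ≤ g₀ / 8) :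
    b ≠ 0 ∧ (1 / 2 : ℝ) ≤ (a / b).re := by
  have hbn : 7 * g₀ / 8 ≤ ‖b‖ := by
    have := norm_sub_norm_le G b
    rw [norm_sub_rev] at hb
    linarith
  have hb0 : b ≠ 0 := by
    intro h; rw [h, norm_zero] at hbn; linarith
  refine ⟨hb0, ?_⟩
  have hab : ‖a - b‖ ≤ g₀ / 4 := by
    calc ‖a - b‖ = ‖(a - G) - (b - G)‖ := by ring_nf
      _ ≤ ‖a - G‖ + ‖b - G‖ := norm_sub_le _ _
      _ ≤ g₀ / 4 := by linarith
  have hq : ‖a / b - 1‖ ≤ 2 / 7 := by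
    rw [show a / b - 1 = (a - b) / b by field_simp, norm_div]
    rw [div_le_iff₀ (by linarith)]
    calc ‖a - b‖ ≤ g₀ / 4 := hab
      _ ≤ 2 / 7 * ‖b‖ := by linarith
  have hre' : -‖a / b - 1‖ ≤ (a / b - 1).re := (abs_le.1 (Complex.abs_re_le_norm (a / b - 1))).1
  have : (a / b).re = 1 + (a / b - 1).re := by simp
  rw [this]
  linarith

variable {r : ℕ} {L M : ℕ} [NeZero L] [NeZero M]

/-- The open sup-norm ball of radius `π` lies in the half-open cube `(-π, π]^J`. -/
theorem birUnif_ball_subset {J : Type*} [Fintype J] :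
    Metric.ball (0 : J → ℝ) Real.pi ⊆ Set.pi univ (fun _ : J => Ioc (-Real.pi) Real.pi) := by
  intro δ hδ
  rw [Metric.mem_ball, dist_zero_right] at hδ
  rw [Set.mem_univ_pi]
  intro j
  have h := norm_le_pi_norm δ j
  rw [Real.norm_eq_abs] at h
  have : |δ j| < Real.pi := lt_of_le_of_lt h hδ
  exact ⟨by linarith [(abs_lt.1 this).1], (abs_lt.1 this).2.le⟩

/-- **The uniform core estimate.**  For ONE admissible table `c` and ONE `K ≥ 1`: given the
`c`-independent coercivity constant `m`, the `c`-independent Gaussian lower bound `g₀` on the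
class of symmetric coefficient arrays with entries `≤ 2|Λ| max B 0` and real part `≥ m Σu²`, and
`K` large enough for the two `O(1/√K)` Laplace errors to be `≤ g₀/8`, the typed conclusion
holds. -/
theorem birUnif_core {B : ℝ}
    (c : ((Fin r × Fin r × Fin r) → ℤ) →₀ ℂ)
    (hU1 : ∀ n ∈ c.support, ∑ w, n w = 0) (hN : c.sum (fun _ a => a) = 0)
    (hA : c.sum (fun n a => ‖a‖ * Real.exp (∑ w, |(n w : ℝ)|)) ≤ B)
    {F : ((Fin r × Fin r × Fin r) → ℝ) → ℂ}
    (hF : ∀ φ, F φ = c.sum (fun n a => a * cexp (I * ((∑ w, (n w : ℝ) * φ w : ℝ) : ℂ))))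
    {sh : (TorusSite 2 L × ZMod M) → (Fin r × Fin r × Fin r) → (TorusSite 2 L × ZMod M)}
    (hsh : ∀ s w, sh s w = (s.1 + ![((w.1 : ℕ) : ZMod L), ((w.2.1 : ℕ) : ZMod L)],
      s.2 + ((w.2.2 : ℕ) : ZMod M)))
    {O : ((TorusSite 2 L × ZMod M) → ℝ) → ℝ}
    (hO : ∀ θ, O θ = ‖∑ x : TorusSite 2 L, cexp (I * (θ (x, 0) : ℂ))‖ ^ 2 / (L : ℝ) ^ 4)
    {m : ℝ} (hm : 0 < m)
    (hcoer : ∀ δ ∈ Set.pi univ (fun _ : {i // i ≠ (0 : TorusSite 2 L × ZMod M)} => Icc (-Real.pi) Real.pi),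
      m * ∑ j, δ j ^ 2 ≤ (∑ s, F (fun w =>
        (fun i => if h : i = (0 : TorusSite 2 L × ZMod M) then (0 : ℝ) else δ ⟨i, h⟩) (sh s w))).re)
    {g₀ : ℝ} (hg₀ : 0 < g₀)
    (hGlow : ∀ Q : {i // i ≠ (0 : TorusSite 2 L × ZMod M)} → {i // i ≠ (0 : TorusSite 2 L × ZMod M)} → ℂ,
      (∀ i j, Q i j = Q j i) →
      (∀ i j, ‖Q i j‖ ≤ 2 * Fintype.card (TorusSite 2 L × ZMod M) * max B 0) →
      (∀ u : {i // i ≠ (0 : TorusSite 2 L × ZMod M)} → ℝ,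
        m * ∑ i, u i ^ 2 ≤ ((1 / 2 : ℂ) * ∑ i, ∑ j, Q i j * u i * u j).re) →
      g₀ ≤ ‖∫ u : {i // i ≠ (0 : TorusSite 2 L × ZMod M)} → ℝ,
        cexp (-((1 / 2 : ℂ) * ∑ i, ∑ j, Q i j * u i * u j))‖)
    {K : ℝ} (hK : 1 ≤ K)
    (hεZ : (0 * ((1 + 2 / m) / 2) + 1 * (Fintype.card (TorusSite 2 L × ZMod M) * max B 0)
        * ((2 / m) * (1 + 4 / m)) + 2 * 1 / (m * Real.pi ^ 2))
        * (∫ u : {i // i ≠ (0 : TorusSite 2 L × ZMod M)} → ℝ, Real.exp (-(m / 2) * ∑ i, u i ^ 2))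
        / Real.sqrt K ≤ g₀ / 8)
    (hεN : (2 * ((1 + 2 / m) / 2) + 1 * (Fintype.card (TorusSite 2 L × ZMod M) * max B 0)
        * ((2 / m) * (1 + 4 / m)) + 2 * 1 / (m * Real.pi ^ 2))
        * (∫ u : {i // i ≠ (0 : TorusSite 2 L × ZMod M)} → ℝ, Real.exp (-(m / 2) * ∑ i, u i ^ 2))
        / Real.sqrt K ≤ g₀ / 8) :
    (∫ θ in Set.pi univ (fun _ : TorusSite 2 L × ZMod M => Icc (0 : ℝ) (2 * Real.pi)),
        cexp (-((K : ℂ) * ∑ s, F (fun w => θ (sh s w))))) ≠ 0 ∧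
    (1 / 2 : ℝ) ≤ ((∫ θ in Set.pi univ (fun _ : TorusSite 2 L × ZMod M => Icc (0 : ℝ) (2 * Real.pi)),
        ((O θ : ℝ) : ℂ) * cexp (-((K : ℂ) * ∑ s, F (fun w => θ (sh s w))))) /
      (∫ θ in Set.pi univ (fun _ : TorusSite 2 L × ZMod M => Icc (0 : ℝ) (2 * Real.pi)),
        cexp (-((K : ℂ) * ∑ s, F (fun w => θ (sh s w)))))).re := by
  set s₀ : TorusSite 2 L × ZMod M := 0 with hs₀
  set Nc : ℝ := (Fintype.card (TorusSite 2 L × ZMod M) : ℝ) with hNc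
  set B' : ℝ := max B 0 with hB'
  have hB'0 : 0 ≤ B' := le_max_right _ _
  have hA' : c.sum (fun n a => ‖a‖ * Real.exp (∑ w, |(n w : ℝ)|)) ≤ B' := hA.trans (le_max_left _ _)
  -- the sheared phase, amplitude and domain
  set f : ({i // i ≠ s₀} → ℝ) → ℂ := fun δ =>
      ∑ s, F (fun w => (fun i => if h : i = s₀ then (0 : ℝ) else δ ⟨i, h⟩) (sh s w)) with hf
  set g : ({i // i ≠ s₀} → ℝ) → ℂ := fun δ =>
      ((O (fun i => if h : i = s₀ then (0 : ℝ) else δ ⟨i, h⟩) : ℝ) : ℂ) with hg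
  set S : Set ({i // i ≠ s₀} → ℝ) := Set.pi univ (fun _ => Ioc (-Real.pi) Real.pi) with hS
  -- weights, linear forms, coefficient array and quadratic germ
  set wt : (TorusSite 2 L × ZMod M) × ↥c.support → ℂ := fun k => c k.2 with hwt
  set av : (TorusSite 2 L × ZMod M) × ↥c.support → {i // i ≠ s₀} → ℝ := fun k j =>
      ∑ w, ((k.2 : (Fin r × Fin r × Fin r) → ℤ) w : ℝ) * (if sh k.1 w = j.1 then (1 : ℝ) else 0)
    with hav
  set Q : {i // i ≠ s₀} → {i // i ≠ s₀} → ℂ := fun i j => -(∑ k, wt k * (av k i : ℂ) * av k j) with hQ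
  set q : ({i // i ≠ s₀} → ℝ) → ℂ := fun u => (1 / 2 : ℂ) * ∑ i, ∑ j, Q i j * u i * u j with hq
  -- continuity and the expansion
  have hf_cont : Continuous f :=
    (birAct_continuous_action c hF sh).comp (birTorus_continuous_ext s₀)
  have hq_cont : Continuous q := by
    simp only [hq]
    refine continuous_const.mul (continuous_finsetSum _ fun i _ => ?_)
    refine continuous_finsetSum _ fun j _ => ?_
    exact ((continuous_const.mul (Complex.continuous_ofReal.comp (continuous_apply i))).mul
      (Complex.continuous_ofReal.comp (continuous_apply j)))
  have hforms : ∀ δ, f δ = ∑ k, wt k * cexp (I * ((∑ j, av k j * δ j : ℝ) : ℂ)) :=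
    fun δ => birAct_action_eq_sum_forms c hF sh s₀ δ
  have hNw : ∑ k, wt k = 0 := birAct_weights_sum_eq_zero c hN
  have hUw : ∀ δ : {i // i ≠ s₀} → ℝ, ∑ k, wt k * ((∑ j, av k j * δ j : ℝ) : ℂ) = 0 :=
    fun δ => birAct_weighted_forms_eq_zero c hU1 hsh s₀ δ
  have hqm : ∀ δ : {i // i ≠ s₀} → ℝ,
      -(1 / 2 : ℂ) * ∑ k, wt k * ((∑ j, av k j * δ j : ℝ) : ℂ) ^ 2 = q δ := by
    intro δ
    rw [birExpand_quad_eq_matrix]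
  have hCc : (∑ k, ‖wt k‖ * (∑ j, |av k j|) ^ 3) / 6 ≤ Nc * B' :=
    birUnif_remainder_const_le c hA' s₀ sh
  have hrem : ∀ δ : {i // i ≠ s₀} → ℝ, ‖f δ - q δ‖ ≤ (Nc * B') * (∑ j, δ j ^ 2) * ‖δ‖ := by
    intro δ
    have h := birExpand_norm_sub_quad_le wt av hNw hUw δ
    rw [← hforms δ, hqm δ] at h
    refine h.trans ?_
    have h0 : 0 ≤ (∑ j, δ j ^ 2) * ‖δ‖ :=
      mul_nonneg (Finset.sum_nonneg fun j _ => sq_nonneg _) (norm_nonneg _)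
    nlinarith
  have hqhom : ∀ (t : ℝ) (u : {i // i ≠ s₀} → ℝ), q (t • u) = (t : ℂ) ^ 2 * q u := by
    intro t u
    simp only [hq, Pi.smul_apply, smul_eq_mul, Complex.ofReal_mul, Finset.mul_sum]
    refine Finset.sum_congr rfl fun i _ => Finset.sum_congr rfl fun j _ => ?_
    ring
  -- coercive lower bound on the half-open cube, with the uniform `m`
  have hreS : ∀ δ ∈ S, m * ∑ j, δ j ^ 2 ≤ (f δ).re := fun δ hδ =>
    hcoer δ (Set.pi_mono (fun _ _ => Ioc_subset_Icc_self) hδ)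
  have hremS : ∀ δ ∈ S, ‖f δ - q δ‖ ≤ (Nc * B') * (∑ j, δ j ^ 2) * ‖δ‖ := fun δ _ => hrem δ
  -- the domain
  have hSm : MeasurableSet S := MeasurableSet.univ_pi fun _ => measurableSet_Ioc
  have hball : Metric.ball (0 : {i // i ≠ s₀} → ℝ) Real.pi ⊆ S := birUnif_ball_subset
  have hS0 : S ∈ 𝓝 (0 : {i // i ≠ s₀} → ℝ) :=
    mem_of_superset (Metric.ball_mem_nhds 0 Real.pi_pos) hball
  -- the amplitudes
  have hg_cont : Continuous g :=
    Complex.continuous_ofReal.comp ((birAct_O_continuous hO).comp (birTorus_continuous_ext s₀))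
  have hg_b : ∀ δ ∈ S, ‖g δ‖ ≤ 1 := by
    intro δ _
    simp only [hg, Complex.norm_real, Real.norm_eq_abs]
    rw [abs_of_nonneg (birLat_O_nonneg hO _)]
    exact birLat_O_le_one hO _
  have hext0 : (fun i : TorusSite 2 L × ZMod M =>
      if h : i = s₀ then (0 : ℝ) else (0 : {i // i ≠ s₀} → ℝ) ⟨i, h⟩) = fun _ => 0 := by
    funext i
    by_cases h : i = s₀ <;> simp [h]
  have hg0 : g 0 = 1 := by
    simp only [hg, hext0, birLat_O_zero hO, Complex.ofReal_one]
  have hg_L : ∀ δ ∈ S, ‖g δ - g 0‖ ≤ 2 * ‖δ‖ := by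
    intro δ _
    simp only [hg]
    rw [← Complex.ofReal_sub, Complex.norm_real, Real.norm_eq_abs]
    refine (birUnif_O_lipschitz hO _ _).trans ?_
    exact mul_le_mul_of_nonneg_left (birUnif_norm_ext_le s₀ δ) (by norm_num)
  have h1_b : ∀ δ ∈ S, ‖(fun _ : {i // i ≠ s₀} → ℝ => (1 : ℂ)) δ‖ ≤ 1 := fun δ _ => by simp
  have h1_L : ∀ δ ∈ S, ‖(fun _ : {i // i ≠ s₀} → ℝ => (1 : ℂ)) δ - (fun _ : {i // i ≠ s₀} → ℝ => (1 : ℂ)) 0‖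
      ≤ 0 * ‖δ‖ := fun δ _ => by simp
  -- the Gaussian lower bound applies to `Q`
  have hQsymm : ∀ i j, Q i j = Q j i := by
    intro i j
    simp only [hQ]
    congr 1
    refine Finset.sum_congr rfl fun k _ => ?_
    ring
  have hQentry : ∀ i j, ‖Q i j‖ ≤ 2 * Nc * B' := fun i j => birUnif_entry_le c hA' s₀ sh i j
  have hQre : ∀ u : {i // i ≠ s₀} → ℝ, m * ∑ i, u i ^ 2 ≤ ((1 / 2 : ℂ) * ∑ i, ∑ j, Q i j * u i * u j).re :=
    fun u => birLaplace_re_quad_ge hS0 hqhom hreS hremS u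
  have hGlow' : g₀ ≤ ‖∫ u : {i // i ≠ s₀} → ℝ, cexp (-q u)‖ := hGlow Q hQsymm hQentry hQre
  -- the two Laplace rates
  have hCu : 0 ≤ Nc * B' := by positivity
  have hrateZ := birLaplace_rate hSm Real.pi_pos hball hf_cont hq_cont hqhom hm hCu hreS hremS
    (g := fun _ => (1 : ℂ)) continuous_const (G₀ := 1) (Lg := 0) le_rfl h1_b h1_L hK
  have hrateN := birLaplace_rate hSm Real.pi_pos hball hf_cont hq_cont hqhom hm hCu hreS hremS
    hg_cont (G₀ := 1) (Lg := 2) (by norm_num) hg_b hg_L hK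
  rw [hg0] at hrateN
  simp only [one_mul, mul_one, zero_mul, zero_add] at hrateZ hrateN hεZ hεN
  -- the shear representations of `Z` and of the numerator
  have h2π : ((2 * Real.pi : ℝ) : ℂ) ≠ 0 := by exact_mod_cast Real.two_pi_pos.ne'
  have hZ : (∫ θ in Set.pi univ (fun _ : TorusSite 2 L × ZMod M => Icc (0 : ℝ) (2 * Real.pi)),
        cexp (-((K : ℂ) * ∑ s, F (fun w => θ (sh s w)))))
      = ((2 * Real.pi : ℝ) : ℂ) * ∫ δ in S, cexp (-((K : ℂ) * f δ)) := by
    have h := birFixedVolume_cube_to_shear s₀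
      (Φ := fun θ : (TorusSite 2 L × ZMod M) → ℝ => cexp (-((K : ℂ) * ∑ s, F (fun w => θ (sh s w)))))
      (by have := birAct_continuous_action c hF sh; fun_prop)
      (fun θ k => congrArg (fun z => cexp (-((K : ℂ) * z))) (birAct_action_periodic c hF sh θ k))
      (fun θ α => congrArg (fun z => cexp (-((K : ℂ) * z))) (birAct_action_rotate c hU1 hF sh θ α))
    rw [h]
  have hNum : (∫ θ in Set.pi univ (fun _ : TorusSite 2 L × ZMod M => Icc (0 : ℝ) (2 * Real.pi)),
        ((O θ : ℝ) : ℂ) * cexp (-((K : ℂ) * ∑ s, F (fun w => θ (sh s w)))))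
      = ((2 * Real.pi : ℝ) : ℂ) * ∫ δ in S, g δ * cexp (-((K : ℂ) * f δ)) := by
    have h := birFixedVolume_cube_to_shear s₀
      (Φ := fun θ : (TorusSite 2 L × ZMod M) → ℝ =>
        ((O θ : ℝ) : ℂ) * cexp (-((K : ℂ) * ∑ s, F (fun w => θ (sh s w)))))
      (by have := birAct_O_continuous hO; have := birAct_continuous_action c hF sh; fun_prop)
      (fun θ k => congrArg₂ (fun (x : ℝ) (z : ℂ) => (x : ℂ) * cexp (-((K : ℂ) * z)))
        (birAct_O_periodic hO θ k) (birAct_action_periodic c hF sh θ k))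
      (fun θ α => congrArg₂ (fun (x : ℝ) (z : ℂ) => (x : ℂ) * cexp (-((K : ℂ) * z)))
        (birAct_O_rotate hO θ α) (birAct_action_rotate c hU1 hF sh θ α))
    rw [h]
  -- conclude with the ratio control
  have hKpos : 0 < K := by linarith
  have hsK : (((Real.sqrt K) ^ Fintype.card {i // i ≠ s₀} : ℝ) : ℂ) ≠ 0 := by
    exact_mod_cast (pow_pos (Real.sqrt_pos.2 hKpos) _).ne'
  obtain ⟨hb0, hre⟩ := birUnif_ratio hg₀ hGlow' hrateN hrateZ hεN hεZ
  refine ⟨?_, ?_⟩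
  · rw [hZ]
    refine mul_ne_zero h2π fun h0 => hb0 ?_
    rw [h0, mul_zero]
  · rw [hNum, hZ, mul_div_mul_left _ _ h2π]
    rwa [mul_div_mul_left _ _ hsK] at hre

end Uniform

end Summit.HubbardSuperconductivity.HubbardSuperconductivity.Theorems
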